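import Summits.QuantumFields.YangMills.Theorems.UnitScaleTiltFluctuationComparisonRegPrDualWhitney3D

/-!
# Route `UnitScaleTilt` — crux K1bR-pr `FluctuationComparisonRegPr` (stmt-QuantumFields-19201), stub `stub_oneStepSmallLift`
# (W7 line), piece (L1) FOR EVERY ODD BLOCK SIZE: the dual Whitney lift COMMUTES WITH THE COBOUNDARY, `d₁(R₁v) = R₂(d₁v)`
# (support file `--supports stmt-QuantumFields-19201`; sequel of `…DualWhitney3D`; cell `ym3-torus`, seat `ym3-torus-p1` gen 10)

With `…DualWhitney3D`'s `Sline_R1` (`S∘R₁ = 1`) and `norm_R2_le` (`‖R₂‖_{∞→∞} ≤ 8L⁴/(L²+1)³`), the identity `d1_R1` proved here closes the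
LINEAR one-step lift for every odd `L ≥ 5`: `u := R₁v` has line average `v` exactly and fine curvature `d₁u = R₂(d₁v)` bounded
plaquette-wise by `8L⁴/(L²+1)³ · sup‖d₁v‖ < L^{-1/2} sup‖d₁v‖`.  The proof is the tensor form of the one-dimensional STEP identity
`L(Φ₀(s) − Φ₀(s+1)) = Φ₁(s) − Φ₁(s+L)` (`phi0_step`): shifting the fine plaquette by `e_ν` changes only the `ν`-factor of the weight, and
the change is `L⁻¹` times a difference of `R₂`-weights at `y` and `y − e_ν` (`wt1_sub_wt1_shift`); re-indexing the block sum
(`sum_win_shift`, the weights vanish off the radius-1 box) turns the four terms of `d₁(R₁v)` into `R₂` applied to the four terms of `d₁v`.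
Elementary finite sums; nothing of Bałaban's is asserted.
-/

noncomputable section


namespace Summit.QuantumFields.YangMills.Theorems.DualWhitney

open Finset

variable {E : Type*} [NormedAddCommGroup E] [NormedSpace ℝ E]
variable (h : ℕ)

/-! ## §11 Shifts by a unit vector -/

/-- Shifting a fine site by `e_a` moves its block index by `0` or `1` in direction `a` and not at all in the others. -/
theorem blk_add_unit (z : Site) (a b : Fin 3) :
    blk h z b ≤ blk h (z + unit a) b ∧ blk h (z + unit a) b ≤ blk h z b + 1 := by
  have hL : (0 : ℤ) < bL h := by rw [bL_int]; omega
  unfold blk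
  simp only [Pi.add_apply, unit_apply]
  constructor
  · exact Int.ediv_le_ediv hL (by split_ifs <;> omega)
  · calc (z b + (if b = a then (1:ℤ) else 0) + h) / (bL h : ℤ)
        ≤ (z b + h + 1 * (bL h : ℤ)) / (bL h : ℤ) := Int.ediv_le_ediv hL (by split_ifs <;> omega)
      _ = (z b + h) / (bL h : ℤ) + 1 := by rw [Int.add_mul_ediv_right _ _ hL.ne']

/-- The support box at `z + e_a` lies in the radius-2 window at `z`. -/
theorem supp1_add_unit_subset_win (z : Site) (a : Fin 3) : supp1 h (z + unit a) ⊆ win h z := by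
  intro y hy
  unfold supp1 at hy; unfold win
  rw [Fintype.mem_piFinset] at hy ⊢
  intro b
  have h1 := hy b; have h2 := blk_add_unit h z a b
  rw [mem_Icc] at h1 ⊢; omega

/-- Translating the support box by `e_a` stays in the radius-2 window. -/
theorem add_unit_mem_win {z y : Site} (hy : y ∈ supp1 h z) (a : Fin 3) : y + unit a ∈ win h z := by
  unfold supp1 at hy; unfold win
  rw [Fintype.mem_piFinset] at hy ⊢
  intro b
  have h1 := hy b
  simp only [Pi.add_apply, unit_apply]
  rw [mem_Icc] at h1 ⊢; split_ifs <;> omega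

/-- `R₁` at `z + e_a` as a sum over the window at `z`. -/
theorem R1_add_unit_eq (v : Site → Fin 3 → E) (z : Site) (a μ : Fin 3) :
    R1 h v (z + unit a) μ = ((bL h : ℝ))⁻¹ • ∑ y ∈ win h z, wt1 h μ (z + unit a) y • v y μ := by
  rw [R1_eq, ← sum_wt1_subset h μ (supp1_add_unit_subset_win h z a)]

/-- `wt2` is symmetric in its two directions. -/
theorem wt2_comm (μ ν : Fin 3) (z y : Site) : wt2 h μ ν z y = wt2 h ν μ z y := by
  unfold wt2
  refine prod_congr rfl fun a _ => ?_
  simp only [or_comm]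

/-! ## §12 The step identity in tensor form and the re-indexing of block sums -/

/-- **STEP IDENTITY, TENSOR FORM**: for `μ ≠ ν`, shifting the fine site by `e_ν` changes the `R₁`-weight in direction `μ` by
`L⁻¹ × (R₂-weight at y − R₂-weight at y − e_ν)` (`h ≥ 1`). -/
theorem wt1_sub_wt1_shift (hh : 1 ≤ h) {μ ν : Fin 3} (hμν : μ ≠ ν) (z y : Site) :
    wt1 h μ z y - wt1 h μ (z + unit ν) y = ((bL h : ℝ))⁻¹ * (wt2 h μ ν z y - wt2 h μ ν z (y - unit ν)) := by
  have hL := bL_pos h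
  set G : Fin 3 → ℤ → ℝ := fun a x => if a = μ then phi1 h (x - bL h * y a) else phi0 h (x - bL h * y a) with hG
  set Q : ℝ := ∏ a, if a = ν then (1 : ℝ) else G a (z a) with hQ
  have hGν : ∀ x, G ν x = phi0 h (x - bL h * y ν) := fun x => by
    simp only [hG]; rw [if_neg (fun e => hμν e.symm)]
  have s1 : wt1 h μ z y = G ν (z ν) * Q := by
    unfold wt1; rw [hQ, ← prod_ite_split]
    refine prod_congr rfl fun a _ => ?_
    by_cases ha : a = ν
    · subst ha; simp [hG]
    · simp [hG, ha]
  have s2 : wt1 h μ (z + unit ν) y = G ν (z ν + 1) * Q := by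
    unfold wt1; rw [hQ, ← prod_ite_split]
    refine prod_congr rfl fun a _ => ?_
    by_cases ha : a = ν
    · subst ha; simp [hG, unit_apply]
    · simp [hG, unit_apply, ha]
  have s3 : wt2 h μ ν z y = phi1 h (z ν - bL h * y ν) * Q := by
    unfold wt2; rw [hQ, ← prod_ite_split]
    refine prod_congr rfl fun a _ => ?_
    by_cases ha : a = ν
    · subst ha; simp
    · simp [hG, ha]
  have s4 : wt2 h μ ν z (y - unit ν) = phi1 h (z ν - bL h * y ν + bL h) * Q := by
    unfold wt2; rw [hQ, ← prod_ite_split]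
    refine prod_congr rfl fun a _ => ?_
    by_cases ha : a = ν
    · subst ha; simp [unit_apply]; ring_nf
    · simp [hG, unit_apply, ha]
  rw [s1, s2, s3, s4, hGν, hGν, ← sub_mul, ← sub_mul]
  have step := phi0_step h hh (z ν - bL h * y ν)
  have e1 : z ν + 1 - (bL h : ℤ) * y ν = z ν - bL h * y ν + 1 := by ring
  rw [e1]
  have : phi0 h (z ν - ↑(bL h) * y ν) - phi0 h (z ν - ↑(bL h) * y ν + 1)
      = ((bL h : ℝ))⁻¹ * (phi1 h (z ν - ↑(bL h) * y ν) - phi1 h (z ν - ↑(bL h) * y ν + ↑(bL h))) := by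
    rw [← step]; field_simp
  rw [this]; ring

/-- **RE-INDEXING OF BLOCK SUMS**: since the `R₂`-weights at `z` vanish off the radius-1 box and the window has radius 2, the
block sum may be shifted by a unit vector: `Σ_y wt2(z, y − e_a)·g(y) = Σ_y wt2(z, y)·g(y + e_a)`. -/
theorem sum_win_shift (μ ν : Fin 3) (z : Site) (a : Fin 3) (g : Site → E) :
    ∑ y ∈ win h z, wt2 h μ ν z (y - unit a) • g y = ∑ y ∈ win h z, wt2 h μ ν z y • g (y + unit a) := by
  set F : Site → E := fun w => wt2 h μ ν z w • g (w + unit a) with hF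
  have hF0 : ∀ w, w ∉ supp1 h z → F w = 0 := fun w hw => by simp only [hF]; rw [wt2_eq_zero h μ ν hw, zero_smul]
  have hsub : supp1 h z ⊆ (win h z).image (fun y => y - unit a) := by
    intro w hw
    exact mem_image.mpr ⟨w + unit a, add_unit_mem_win h hw a, by simp⟩
  calc ∑ y ∈ win h z, wt2 h μ ν z (y - unit a) • g y
      = ∑ y ∈ win h z, F (y - unit a) := sum_congr rfl fun y _ => by simp only [hF, sub_add_cancel]
    _ = ∑ w ∈ (win h z).image (fun y => y - unit a), F w :=
        (sum_image fun x _ y _ hxy => by simpa using hxy).symm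
    _ = ∑ w ∈ supp1 h z, F w := (sum_subset hsub fun w _ hw => hF0 w hw).symm
    _ = ∑ w ∈ win h z, F w := sum_subset (supp1_subset_win h z) fun w _ hw => hF0 w hw

/-- One direction of the curvature computation: `Σ_y (wt1(z,y) − wt1(z+e_ν,y))·v(y;μ) = L⁻¹ Σ_y wt2(z,y)·(v(y;μ) − v(y+e_ν;μ))`. -/
theorem sum_wt1_sub_shift (hh : 1 ≤ h) {μ ν : Fin 3} (hμν : μ ≠ ν) (v : Site → Fin 3 → E) (z : Site) :
    ∑ y ∈ win h z, wt1 h μ z y • v y μ - ∑ y ∈ win h z, wt1 h μ (z + unit ν) y • v y μ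
      = ((bL h : ℝ))⁻¹ • ∑ y ∈ win h z, wt2 h μ ν z y • (v y μ - v (y + unit ν) μ) := by
  rw [← sum_sub_distrib]
  simp_rw [← sub_smul, wt1_sub_wt1_shift h hh hμν, mul_smul, ← smul_sum]
  congr 1
  simp_rw [sub_smul, smul_sub]
  rw [sum_sub_distrib, sum_sub_distrib, sum_win_shift]

/-- **`d₁ ∘ R₁ = R₂ ∘ d₁`**: the fine curvature of the dual Whitney lift of `v` is the `R₂`-interpolant of the coarse curvature
of `v` (`h ≥ 1`).  With `norm_R2_le`: `‖d₁(R₁v)(z;μν)‖ ≤ 8L⁴/(L²+1)³ · sup‖d₁v‖` at every fine plaquette. -/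
theorem d1_R1 (hh : 1 ≤ h) (v : Site → Fin 3 → E) (z : Site) (μ ν : Fin 3) :
    d1 (R1 h v) z μ ν = R2 h (d1 v) z μ ν := by
  have hL := bL_pos h
  by_cases hμν : μ = ν
  · subst hμν
    have h0 : ∀ (w : Site → Fin 3 → E) (x : Site), d1 w x μ μ = 0 := fun w x => by unfold d1; abel
    rw [h0]; unfold R2; simp_rw [h0, smul_zero, sum_const_zero, smul_zero]
  · have hνμ : ν ≠ μ := fun e => hμν e.symm
    have e : d1 (R1 h v) z μ ν
        = (R1 h v z μ - R1 h v (z + unit ν) μ) - (R1 h v z ν - R1 h v (z + unit μ) ν) := by unfold d1; abel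
    rw [e, R1_add_unit_eq h v z ν μ, R1_add_unit_eq h v z μ ν]
    unfold R1
    rw [← smul_sub, ← smul_sub, sum_wt1_sub_shift h hh hμν v z, sum_wt1_sub_shift h hh hνμ v z, ← smul_sub, ← smul_sub,
      smul_smul]
    simp_rw [wt2_comm h ν μ]
    rw [← sum_sub_distrib]
    unfold R2
    have hsc : ((bL h : ℝ))⁻¹ * ((bL h : ℝ))⁻¹ = ((bL h : ℝ) ^ 2)⁻¹ := by rw [← mul_inv, sq]
    rw [hsc]
    congr 1
    refine sum_congr rfl fun y _ => ?_
    rw [← smul_sub]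
    congr 1
    unfold d1; abel

/-- **THE LINEAR ONE-STEP LIFT FOR EVERY ODD `L ≥ 5`, PACKAGED**: `u := R₁v` has line average `v` EXACTLY and fine curvature
bounded plaquette-wise by `8L⁴/(L²+1)³ × sup‖d₁v‖`, and `8L⁴/(L²+1)³·√L < 1` (`h ≥ 2`). -/
theorem linear_lift (hh : 2 ≤ h) (v : Site → Fin 3 → E) {M : ℝ} (hM : ∀ y, ∀ μ ν : Fin 3, ‖d1 v y μ ν‖ ≤ M) :
    (∀ y μ, Sline h (R1 h v) y μ = v y μ) ∧
    (∀ z, ∀ μ ν : Fin 3, ‖d1 (R1 h v) z μ ν‖ ≤ 8 * (bL h : ℝ) ^ 4 / ((bL h : ℝ) ^ 2 + 1) ^ 3 * M) ∧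
    8 * (bL h : ℝ) ^ 4 / ((bL h : ℝ) ^ 2 + 1) ^ 3 * Real.sqrt (bL h) < 1 := by
  have hh1 : 1 ≤ h := le_trans (by norm_num) hh
  refine ⟨fun y μ => Sline_R1 h hh1 v y μ, fun z μ ν => ?_, gain_mul_sqrt_lt_one h hh⟩
  rw [d1_R1 h hh1]
  exact norm_R2_le' h (d1 v) hM z μ ν

end Summit.QuantumFields.YangMills.Theorems.DualWhitney
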